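import Summits.CriticalPhenomena.PercolationContinuityZ3.Theorems.FK.DLRSandwich
import Summits.CriticalPhenomena.PercolationContinuityZ3.Theorems.FK.InfiniteVolumeClosedBoundaryFree
import HarnessLib

/-!
# FK-continuity cell, FO-10a: the FREE domain Markov property of a DLR random-cluster measure across a
# closed edge boundary — `P(A ∩ H) = φ⁰_{Λ,p,q}(A) · P(H)` for every `P ∈ R_{p,q}` (Grimmett 2006, Lemma (4.13)
# free case inside the DLR equation (4.30))

Registered R78 (cell INBOX l.5727, 2026-08-23); registry row FO-10a-g336f; label DFR-A (coordinator fk-4 g167).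
Cell `fk-continuity` (bschramm), row FO-10a (domain-Markov + comparison layer over FO-06); support file for the
FK-continuity transplant (`--supports stmt-CriticalPhenomena-4575`); builds on p205010 (kernel theorem, internal audit
signed; external expert review pending). Pure proofs; no definitions, no named facts, no sorries; general dimension `d`.

`InfiniteVolumeClosedBoundaryFree.lean` (row FO-10a-g335, NPC-A) proved the free Markov property across a closed
edge boundary for the box laws and the box limits `φ^b_{p,q}`; `DLRSandwich.lean` (row FO-10a-g335d, DLS-C) proved the
two-sided SANDWICH `φ⁰_Λ(A) P(H) ≤ P(A ∩ H) ≤ φ¹_Λ(A) P(H)` for every lattice-carried DLR measure `P`. This file proves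
the EXACT free case for the DLR class `R_{p,q}` of Def. (4.29):

* `sum_rcCondProb_empty_eq_regionFreeReal` — **the specification kernel with empty boundary condition is the free
  region law**: `Σ_{η ⊆ E_Λ, η ∈ A} φ^∅_{Λ,p,q}(η) = φ⁰_{Λ,p,q}(A)` (read off the exact box identity of
  `DLRKernelSandwich.lean` at `ζ = ∅` against NPC-A's box Markov property, the conditioning event having positive mass);
* `reachable_union_sdiff_iff_of_closed`, `rcCondProb_eq_rcCondProb_empty_of_closed` — **a lattice boundary condition
  `ξ` whose edges leaving `Λ` are all closed induces the free kernel**: `φ^ξ_{Λ,p,q} = φ^∅_{Λ,p,q}` (no open path can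
  leave `Λ`, so `ξ` wires nothing; `rcCondProb_congr_of_forall_reachable_iff`);
* **`IsDLRRandomCluster.real_inter_eq_regionFreeReal_mul_of_closed`** — for `P ∈ R_{p,q}` carried by lattice
  configurations (`0 < p < 1`, `q > 0`), `Λ` finite, `A` determined by `E_Λ`, `H` determined by a finite pair set
  disjoint from `E_Λ` with every lattice edge leaving `Λ` closed on `H`: `P(A ∩ H) = φ⁰_{Λ,p,q}(A) · P(H)`.

Consumer: `DLRUniquenessOfNonPercolation.lean` (every non-percolating DLR measure is `φ⁰_{p,q}`).

## References
* G. Grimmett, *The Random-Cluster Model*, Springer 2006 (`book:grimmett2006-random-cluster-model`): §4.2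
  (4.11)–(4.13), Lemma (4.13); §4.4 Def. (4.29)–(4.30), Thm. (4.31), Lemma (4.39) [PDF pp. 70–72, 81–83]. [Grimmett2006]
-/

noncomputable section

open MeasureTheory Set Filter
open scoped Topology ENNReal

namespace Summit.CriticalPhenomena.PercolationContinuityZ3.Theorems.FK

open Literature.Probability.Percolation Literature.Probability.LatticeModels

variable {d : ℕ} {p q : ℝ}

/-! ### The kernel with empty boundary condition is the free region law -/

open Classical in
/-- **`Σ_{η ⊆ E_Λ, η ∈ A} φ^∅_{Λ,p,q}(η) = φ⁰_{Λ,p,q}(A)`** for `A` determined by `E_Λ` (`0 < p < 1`, `q > 0`): in the box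
`Λ_{m+1}` (`Λ ⊆ Λ_{m-1}`), on the positive-probability event `H' = {ω = ∅ on Λ_m² ∖ E_Λ} ∖ D_m(Λ)` the box law of
`A ∩ H'` is `(Σ_η φ^∅_Λ(η) 1_A) · φ(H')` (`DLRKernelSandwich.lean`) and also `φ⁰_Λ(A) · φ(H')` (every edge leaving `Λ`
is closed on `H'`; NPC-A's box Markov property). [cite: Grimmett2006, §4.2 (4.12)–(4.13) with Lemma (4.13)] -/
theorem sum_rcCondProb_empty_eq_regionFreeReal (hp : p ∈ Set.Ioo (0 : ℝ) 1) (hq : 0 < q) (Λ : Finset (Site d))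
    {A : Set (BondConfig (Site d))} (hAΛ : DeterminedBy A ↑(edgesIn (zdGraph d) Λ)) :
    ∑ η ∈ ((edgesIn (zdGraph d) Λ).powerset.filter
        (fun η : Finset (Sym2 (Site d)) => ((η : Set (Sym2 (Site d))) ∈ A))),
      rcCondProb p q Λ (∅ : BondConfig (Site d)) η = regionFreeReal d p q Λ A := by
  have hp' : p ∈ Set.Icc (0 : ℝ) 1 := ⟨hp.1.le, hp.2.le⟩
  have hAm : MeasurableSet A := measurableSet_of_isLocalEvent_holds ⟨_, hAΛ⟩
  -- the box `Λ_m`, `m = sup siteRad + 1`, contains `Λ` and all its neighbours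
  set m : ℕ := Λ.sup siteRad + 1 with hm
  have hΛm' : Λ ⊆ box d (Λ.sup siteRad) := subset_box_of_sup_siteRad_le le_rfl
  have hΛm : Λ ⊆ box d m := fun x hx => box_mono d (Nat.le_succ _) (hΛm' hx)
  have hζ : (∅ : Finset (Sym2 (Site d))) ⊆ (box d m).sym2 \ edgesIn (zdGraph d) Λ := Finset.empty_subset _
  set H' : Set (BondConfig (Site d)) :=
    cylEvent ((box d m).sym2 \ edgesIn (zdGraph d) Λ) ∅ ∩ (regionBadEvent Λ m)ᶜ with hH'
  have hH'm : MeasurableSet H' := (measurableSet_cylEvent _ _).inter (measurableSet_regionBadEvent Λ m).compl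
  -- (1) the kernel form of the box law on `A ∩ H'`
  have h1 := rcBoxLaw_real_inter_cyl_eq_sum_rcCondProb_mul false hp' hq hΛm hζ hAΛ hAm
  rw [Finset.coe_empty] at h1
  -- (2) the free Markov property of the box law across the closed boundary `H'`
  have hHc : ∀ ω ∈ H', ∀ x ∈ Λ, ∀ y ∉ Λ, (zdGraph d).Adj x y → s(x, y) ∉ ω := by
    intro ω hω x hx y hy hxy
    have hmem : s(x, y) ∈ (box d m).sym2 \ edgesIn (zdGraph d) Λ := by
      rw [Finset.mem_sdiff, Finset.mk_mem_sym2_iff, mem_edgesIn_iff]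
      exact ⟨⟨hΛm hx, mem_box_succ_of_adj hxy (hΛm' hx)⟩, fun h => hy (h.2 y (Sym2.mem_mk_right x y))⟩
    have := (mem_cylEvent_iff.1 hω.1) _ hmem
    simpa using this
  have h2 : (rcBoxLaw d false p q (m + 1)).real (A ∩ H') =
      regionFreeReal d p q Λ A * (rcBoxLaw d false p q (m + 1)).real H' := by
    rw [rcBoxLaw_real_apply false p q (m + 1) (hAm.inter hH'm), rcBoxLaw_real_apply false p q (m + 1) hH'm]
    refine rcBoxMeasure_real_preimage_inter_eq_regionFreeReal_mul hp' hq false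
      (fun x hx => box_mono d (by omega) (hΛm hx))
      (fun x hx => notMem_innerBoundary_box_of_mem_box (by omega) (hΛm hx))
      ((box d (m + 1)).sym2 \ edgesIn (zdGraph d) Λ) hAΛ ?_ (determinedBy_cyl_inter_compl_regionBadEvent Λ m ∅) hHc
    rw [Finset.coe_sdiff]
    exact disjoint_sdiff_left
  -- (3) the conditioning event has positive mass: cancel
  have hpos := rcBoxLaw_real_cyl_inter_compl_regionBadEvent_pos false hp hq hΛm (Finset.empty_subset _)
    (fun e he => by simp at he) (Λ := Λ)
  rw [h1] at h2
  exact mul_right_cancel₀ hpos.ne' h2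

/-! ### A closed lattice boundary condition induces the free kernel -/

/-- For `η ⊆ E_Λ` and a lattice configuration `ξ` all of whose edges leaving `Λ` are closed, two vertices of `Λ` are
joined in `η ∪ (ξ ∖ E_Λ)` iff they are joined in `η`: no open path can leave `Λ`. [cite: Grimmett2006, §4.2 (4.13) (the boundary condition wires nothing)] -/
theorem reachable_union_sdiff_iff_of_closed {Λ : Finset (Site d)} {ξ : BondConfig (Site d)}
    (hξE : ξ ⊆ (zdGraph d).edgeSet) (hξc : ∀ x ∈ Λ, ∀ y ∉ Λ, (zdGraph d).Adj x y → s(x, y) ∉ ξ)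
    {η : Finset (Sym2 (Site d))} (hη : η ⊆ edgesIn (zdGraph d) Λ) {u v : Site d} (hu : u ∈ Λ) :
    (openGraph ((↑η : Set (Sym2 (Site d))) ∪ (ξ \ ↑(edgesIn (zdGraph d) Λ)))).Reachable u v ↔
      (openGraph (↑η : Set (Sym2 (Site d)))).Reachable u v := by
  refine ⟨fun h => ?_, fun h => h.mono (openGraph_mono Set.subset_union_left)⟩
  classical
  obtain ⟨w⟩ := h
  -- the vertices `η`-reachable from `u`; they all lie in `Λ`
  set S : Set (Site d) := {c | (openGraph (↑η : Set (Sym2 (Site d)))).Reachable u c} with hS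
  have huS : u ∈ S := SimpleGraph.Reachable.refl _
  have hSΛ : ∀ c ∈ S, c ∈ Λ := fun c hc =>
    Finset.mem_coe.1 (mem_of_reachable_of_forall_adj_mem (r := (↑Λ : Set (Site d)))
      (fun a b _ hab => by
        rw [openGraph_adj] at hab
        exact Finset.mem_coe.2 ((mem_edgesIn_iff.1 (hη (Finset.mem_coe.1 hab.1))).2 b (Sym2.mem_mk_right a b)))
      (Finset.mem_coe.2 hu) hc)
  by_contra hv
  obtain ⟨dt, -, haS, hbS⟩ := w.exists_boundary_dart S huS hv
  have hadj := dt.adj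
  rw [openGraph_adj] at hadj
  obtain ⟨hmem, hne⟩ := hadj
  rcases hmem with hη' | hξ'
  · -- an `η`-edge keeps us inside `S`
    exact hbS (haS.trans (SimpleGraph.Adj.reachable ((openGraph_adj _ _ _).2 ⟨hη', hne⟩)))
  · -- a `ξ`-edge off `E_Λ` out of `a ∈ Λ` must leave `Λ`, hence is closed: contradiction
    have haΛ : dt.toProd.1 ∈ Λ := hSΛ _ haS
    have hlat : (zdGraph d).Adj dt.toProd.1 dt.toProd.2 := by
      have := hξE hξ'.1
      rwa [SimpleGraph.mem_edgeSet] at this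
    have hbΛ : dt.toProd.2 ∉ Λ := by
      intro hbΛ
      refine hξ'.2 (Finset.mem_coe.2 (mem_edgesIn_iff.2 ⟨(SimpleGraph.mem_edgeSet _).2 hlat, fun z hz => ?_⟩))
      rcases Sym2.mem_iff.1 hz with rfl | rfl
      · exact haΛ
      · exact hbΛ
    exact hξc _ haΛ _ hbΛ hlat hξ'.1

/-- **A closed lattice boundary condition induces the FREE kernel**: if `ξ ⊆ E(ℤ^d)` has every edge leaving `Λ`
closed, then `φ^ξ_{Λ,p,q}(η) = φ^∅_{Λ,p,q}(η)` for every inside pattern `η ⊆ E_Λ`. [cite: Grimmett2006, §4.2 (4.12)–(4.13), Lemma (4.13) (free case)] -/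
theorem rcCondProb_eq_rcCondProb_empty_of_closed {Λ : Finset (Site d)} {ξ : BondConfig (Site d)}
    (hξE : ξ ⊆ (zdGraph d).edgeSet) (hξc : ∀ x ∈ Λ, ∀ y ∉ Λ, (zdGraph d).Adj x y → s(x, y) ∉ ξ)
    {η : Finset (Sym2 (Site d))} (hη : η ⊆ edgesIn (zdGraph d) Λ) :
    rcCondProb p q Λ ξ η = rcCondProb p q Λ (∅ : BondConfig (Site d)) η := by
  refine rcCondProb_congr_of_forall_reachable_iff (fun η' hη' u hu v _ => ?_) hη
  rw [reachable_union_sdiff_iff_of_closed hξE hξc hη' hu, Set.empty_sdiff, Set.union_empty]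

/-! ### The free Markov property of a DLR measure across a closed edge boundary -/

open Classical in
/-- **Free domain Markov property of a DLR random-cluster measure across a closed edge boundary** (Grimmett 2006,
Lemma (4.13), free case, inside the DLR equation (4.30)): for `P ∈ R_{p,q}` carried by lattice configurations
(`0 < p < 1`, `q > 0`), a finite region `Λ`, `A` determined by `E_Λ`, and `H` determined by a finite pair set disjoint
from `E_Λ` such that on `H` every lattice edge with exactly one endpoint in `Λ` is closed,
`P(A ∩ H) = φ⁰_{Λ,p,q}(A) · P(H)` — given a closed edge boundary, the inside of `Λ` is FREE.
[cite: Grimmett2006, Def. (4.29) eq. (4.30) with Lemma (4.13)] -/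
theorem IsDLRRandomCluster.real_inter_eq_regionFreeReal_mul_of_closed {P : Measure (BondConfig (Site d))}
    (hP : IsDLRRandomCluster d p q P) (hE : ∀ᵐ ω ∂P, ω ⊆ (zdGraph d).edgeSet) (hp : p ∈ Set.Ioo (0 : ℝ) 1)
    (hq : 0 < q) (Λ : Finset (Site d)) {A H : Set (BondConfig (Site d))} (T : Finset (Sym2 (Site d)))
    (hAΛ : DeterminedBy A ↑(edgesIn (zdGraph d) Λ)) (hT : Disjoint (↑T : Set (Sym2 (Site d))) ↑(edgesIn (zdGraph d) Λ))
    (hH : DeterminedBy H ↑T) (hHc : ∀ ω ∈ H, ∀ x ∈ Λ, ∀ y ∉ Λ, (zdGraph d).Adj x y → s(x, y) ∉ ω) :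
    P.real (A ∩ H) = regionFreeReal d p q Λ A * P.real H := by
  haveI := hP.isProbabilityMeasure
  have hp' : p ∈ Set.Icc (0 : ℝ) 1 := ⟨hp.1.le, hp.2.le⟩
  have hAm : MeasurableSet A := measurableSet_of_isLocalEvent_holds ⟨_, hAΛ⟩
  have hHm : MeasurableSet H := measurableSet_of_isLocalEvent_holds ⟨T, hH⟩
  set c := regionFreeReal d p q Λ A with hc
  -- a.e. the kernel of `A ∩ H` is `1_H · φ⁰_Λ(A)`
  have hae : ∀ᵐ ξ ∂P, rcCondLaw p q Λ ξ (A ∩ H) = H.indicator (fun _ => ENNReal.ofReal c) ξ := by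
    filter_upwards [hE] with ξ hξ
    rw [rcCondLaw_inter_eq_indicator_mul_ofReal_sum hp' hq Λ ξ hAΛ hT hH hAm hHm]
    by_cases hξH : ξ ∈ H
    · rw [Set.indicator_of_mem hξH, Set.indicator_of_mem hξH, hc,
        ← sum_rcCondProb_empty_eq_regionFreeReal hp hq Λ hAΛ]
      congr 1
      refine Finset.sum_congr rfl fun η hη => ?_
      exact rcCondProb_eq_rcCondProb_empty_of_closed hξ (hHc ξ hξH)
        (Finset.mem_powerset.1 (Finset.mem_filter.1 hη).1)
    · rw [Set.indicator_of_notMem hξH, Set.indicator_of_notMem hξH]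
  have h1 : P (A ∩ H) = ENNReal.ofReal c * P H := by
    rw [← hP.lintegral_rcCondLaw_eq Λ (hAm.inter hHm), lintegral_congr_ae hae, lintegral_indicator_const hHm]
  rw [measureReal_def, h1, ENNReal.toReal_mul, ENNReal.toReal_ofReal (regionFreeReal_nonneg p q Λ A),
    ← measureReal_def]

/-- **One-sided form**: under the same hypotheses and for `A` moreover increasing, `P(A ∩ H) ≤ P'(A) · P(H)` for
every `P'` of the sandwich class `FKGibbs d p q` (the free law of a finite region lies below the class on increasing
events). [cite: Grimmett2006, Lemma (4.13) with Thm. (4.19)(c) eq. (4.21), (4.24)] -/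
theorem IsDLRRandomCluster.real_inter_le_of_closed {P P' : Measure (BondConfig (Site d))}
    (hP : IsDLRRandomCluster d p q P) (hE : ∀ᵐ ω ∂P, ω ⊆ (zdGraph d).edgeSet) (hp : p ∈ Set.Ioo (0 : ℝ) 1)
    (hq : 0 < q) (hP' : FKGibbs d p q P') (Λ : Finset (Site d)) {A H : Set (BondConfig (Site d))}
    (T : Finset (Sym2 (Site d))) (hA : IsUpperSet A) (hAΛ : DeterminedBy A ↑(edgesIn (zdGraph d) Λ))
    (hT : Disjoint (↑T : Set (Sym2 (Site d))) ↑(edgesIn (zdGraph d) Λ)) (hH : DeterminedBy H ↑T)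
    (hHc : ∀ ω ∈ H, ∀ x ∈ Λ, ∀ y ∉ Λ, (zdGraph d).Adj x y → s(x, y) ∉ ω) :
    P.real (A ∩ H) ≤ P'.real A * P.real H := by
  rw [hP.real_inter_eq_regionFreeReal_mul_of_closed hE hp hq Λ T hAΛ hT hH hHc]
  exact mul_le_mul_of_nonneg_right (hP'.regionFreeReal_le Λ hA hAΛ) measureReal_nonneg

end Summit.CriticalPhenomena.PercolationContinuityZ3.Theorems.FK

end
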